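import Summits.KontsevichZagierPeriods.KontsevichZagierPeriods.Theses.VietaFibre
import Summits.KontsevichZagierPeriods.KontsevichZagierPeriods.Theorems.BetaCancellation.Negative.LoadBearing
import Literature.NumberTheory.Transcendental.KZLogCalculusProofs
import HarnessLib

/-!
# Crux `KernelForm` (stmt-KontsevichZagierPeriods-10447), line `Sketch`: positive representations of
# value zero, and the order form of the crux

Two stubs of the line lead's skeleton, both over the Kontsevich–Zagier calculus of `KZCalculus.lean`
(no new definitions):

* `of_mem_relations_of_nonneg_of_value_eq_zero` — **Conjecture 1 for ONE non-negative
  representation**: if `f ≥ 0` on `σ` and `∫_σ f = 0` then `[σ, f] ∈ KZ.relations`. Proof: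
  `f = 0` a.e. on `σ` (`MeasureTheory.integral_eq_zero_iff_of_nonneg_ae`), and an a.e.-vanishing
  semialgebraic integrand gives a relation (domain additivity along the Tarski–Seidenberg zero set,
  the tree's `BetaCancellationNegative.of_mem_relations_of_ae_eq_zero`).
* `kernelForm_iff_forall_exists_nonneg` — **the order form of the crux**: `KernelForm` holds iff
  every formal combination of value `0` is move-equivalent to a SINGLE representation with
  non-negative integrand. (`→`: take the zero representation; `←`: soundness forces that
  representation to have value `0`, so it is a relation by the first stub.)

References: M. Kontsevich, D. Zagier, *Periods* (2001), §1.2 (rules (1)–(3) and Conjecture 1).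
-/

noncomputable section

open MeasureTheory Set
open Literature.NumberTheory.Transcendental

namespace Summit.KontsevichZagierPeriods.KernelForm.LocaliseAtValuePrime

open Summit.KontsevichZagierPeriods.KontsevichZagierPeriods.BetaCancellationNegative
  (of_mem_relations_of_ae_eq_zero)

/-- **A non-negative representation of value `0` is a relation** (Conjecture 1 for one non-negative
representation): `f ≥ 0` on `σ` and `∫_σ f = 0` force `f = 0` a.e. on `σ`, and an a.e.-vanishing
semialgebraic integrand is a relation. [folklore] -/
theorem of_mem_relations_of_nonneg_of_value_eq_zero :
    ∀ {n : ℕ} (r : KZ.IntegralRep n), (∀ x ∈ r.domain, 0 ≤ r.integrand x) → r.value = 0 →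
      KZ.of r ∈ KZ.relations := by
  intro n r h0 hv
  have hmeas : MeasurableSet r.domain := KZ.IntegralRep.measurableSet_domain_holds r
  have hae : 0 ≤ᵐ[volume.restrict r.domain] r.integrand := by
    rw [Filter.EventuallyLE, ae_restrict_iff' hmeas]
    exact Filter.Eventually.of_forall h0
  have h : r.integrand =ᵐ[volume.restrict r.domain] 0 :=
    (integral_eq_zero_iff_of_nonneg_ae hae r.integrableOn).mp hv
  exact of_mem_relations_of_ae_eq_zero r h

/-- **Order form of the kernel conjecture**: `KernelForm` (every formal combination of value `0` is a
relation) holds iff every formal combination of value `0` is move-equivalent to a single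
representation with non-negative integrand. [folklore] -/
theorem kernelForm_iff_forall_exists_nonneg :
    Summit.KontsevichZagierPeriods.KontsevichZagierPeriods.Theses.VietaFibre.KernelForm ↔
      ∀ c : KZ.FormalRep, KZ.eval c = 0 → ∃ (n : ℕ) (r : KZ.IntegralRep n),
        (∀ x ∈ r.domain, 0 ≤ r.integrand x) ∧ c - KZ.of r ∈ KZ.relations := by
  unfold Summit.KontsevichZagierPeriods.KontsevichZagierPeriods.Theses.VietaFibre.KernelForm
  constructor
  · intro hK c hc
    obtain ⟨z, -, hzi⟩ := KZ.exists_zeroRep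
      (Literature.ModelTheory.ExponentialFields.isSemialgebraic_univ (k := ℚ) (ι := Fin 0) (R := ℝ))
    refine ⟨0, z, fun x _ => by simp [hzi], ?_⟩
    have hz : KZ.of z ∈ KZ.relations :=
      KZ.of_mem_relations_of_eqOn_zero z fun x _ => by simp [hzi]
    exact KZ.relations.sub_mem (hK c hc) hz
  · intro h c hc
    obtain ⟨n, r, hr, hcr⟩ := h c hc
    have hval : r.value = 0 := by
      have := KZ.relations_le_ker_eval_holds hcr
      rw [AddMonoidHom.mem_ker, map_sub, KZ.eval_of, hc, zero_sub, neg_eq_zero] at this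
      exact this
    have hr0 : KZ.of r ∈ KZ.relations := of_mem_relations_of_nonneg_of_value_eq_zero r hr hval
    have := KZ.relations.add_mem hcr hr0
    simpa using this

end Summit.KontsevichZagierPeriods.KernelForm.LocaliseAtValuePrime
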